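import Summits.QuantumFields.BalabanUV.Beta.GAN24.FibreRateMF
import Summits.QuantumFields.BalabanUV.Beta.GAN24.FibreRateMM
import Summits.QuantumFields.BalabanUV.Beta.GAN24.FibreRateFeedTerms

/-!
# `BalabanUV.Beta.GAN24.FibreRateFeed` — binder row G-an2-4 / (CONV-C), road P1-fibre, leaf **P1-L11** `FibreRate` (Part B), PART F-feed:
# the gauge constant `cSol` and the FEED readouts as «alias sums × Cap⁻¹ blocks», their scaled bounds, and the fm leg rate AS A FUNCTION of the reading-side data

NOT IN PRINT; OUR PROOF ATTEMPT.  HONEST FRAMING (cell contract, verbatim): «discharging `BetaPertH` makes Bałaban's UV stability UNCONDITIONAL — a real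
constructive-QFT result; it is NOT the continuum limit and NOT the Clay problem.»  HONEST DEPENDENCY (verbatim): «continuum YM on T⁴ ⇐ BetaPertH ∧ nine spine
estimates (0/9 proved); BetaPertH ⇐ (D1) ∧ (D4) ∧ CAP+tail; G-an2-4 gates asym, D1 and NE2/3/4.»  [folklore] finite-sum algebra over T00's definitions
(`AliasObjects.capSol/phiSol/cSol/srcPhi/srcC/Ahat/gAl/readW/fhatF/eVec`) with leaf-11's feed decomposition (`FibreRateFeedTerms.readW_mul_Asol_feed`,
`rPhiTerm`, `rCTerm`; `FibreRateTBlock.ff_summand_split`, `tTerm`) and two-factor telescoping (`ClosedFormRateOfParts.norm_mul_sub_mul_le_of_bounds`) BY NAME,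
times this seat's capacitance half (`CapacitanceEndpoint(Blocks)`, `CapacitanceRate{,Dictionary,Scaled}`); no cited fact, no wall binder, no `def`, no
`def … : Prop` hypothesis — the reading-side / source-side bounds and rates are ORDINARY HYPOTHESES (PART S, leaf-07-g6, supplies them; `R = −conj S` by its
`readingPhi_eq`/`readingC_eq`).  NOT summit progress: pieces of shape (I2′); nothing of (CONV-C)'s K-slot is discharged; 0 wall binders instantiated;
NOT `BetaPertH`, NOT continuum, NOT Clay.

## What is proved (every `D`; real `q ∈ [−π, π]^D ∖ {0}` where bounds/rates appear; `1 ≤ N ≤ N′`)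
* §1 `cSol_eq_sum`, `scaled_cSol_eq` (`N^{D+1}·c = Σ_{l′}(N^{D+4}cap⁻¹_{cl′})(N⁻³r_φ(l′)) + (N^{D+4}cap⁻¹_{cc})(N⁻³r_c)`), `cSol_zero_eVec`
  (`cSol N p 0 (eVec l) = (cap N p)⁻¹ (inr ()) (inl l)`); scaled BOUNDS `norm_scaled_phiSol_le` (`‖N^{D+1}φ_κ‖ ≤ D·cPP|q|²B_φ + cPc|q|²√|q|²B_c`),
  `norm_scaled_cSol_le` (`‖N^{D+1}c‖ ≤ D·cPc|q|²√|q|²B_φ + ccc|q|⁴B_c`) and the RATE **`norm_scaled_cSol_sub_le`**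
  (`≤ (D(crPc|q|⁴√|q|²B_φ + cPc|q|²√|q|²R_φ) + crcc|q|⁶B_c + ccc|q|⁴R_c)/N²`) — companions of `FibreRateMF.norm_scaled_phiSol_sub_le`;
* §2 DECOMPOSITIONS (every complex `p`): `Ahat_zero_eq_feed`; **`sum_readW_Ahat_zero_eVec`**: `Σ_m readW·Â(0, e_l)_κ = Σ_{l′}(Σ_m R_φ)·cap⁻¹_{l′l} + (Σ_m R_c)·cap⁻¹_{cl}`
  (the fm readout has NO T-share); **`sum_readW_Ahat_fhatF`**: `Σ_m readW·Â(f̂, ĉ)_κ = Σ_m tTerm + Σ_{l′}(Σ_m R_φ)·φ_{l′} + (Σ_m R_c)·c` (ff = T-share + feed share);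
* §3 **`scaled_fm_eq`** and **`norm_scaled_fm_sub_le`**: from `‖N⁻³Σ_m R_φ(κ,l′)‖ ≤ A_φ`, `‖N⁻³Σ_m R_c(κ)‖ ≤ A_c` (level `N`) and the two-level rates
  `≤ Q_φ/N²`, `≤ Q_c/N²`: `‖N′^{D+1}F′ − N^{D+1}F‖ ≤ (D(Q_φ·cPP|q|² + A_φ·crPP|q|⁴) + Q_c·cPc|q|²√|q|² + A_c·crPc|q|⁴√|q|²)/N²` for the fm readout
  `F_N = Σ_m readW·Â(0, e_l)_κ` (at `d = 3`, `sfStep Lc j·smStep 3 Lc j = N⁵/Lc⁵` — `FibreRateMF.smStep_mul_sfStep_three` — turns it into the hypothesis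
  `hfm` of `FibreRateOfLegs.realRateK_of_leg_rates` with rate `(Lc⁻²)^j`; that instantiation is the final assembly's).

Unit `b2b-balaban-gan24-formalise-leaf-20` (G-an2-4 formalisation swarm, leaf prover 20), 2026-08-20.  Value = kernel assembly leaf toward the K-slot route P1,
NOT summit progress.
-/

noncomputable section

open Complex Finset
open scoped BigOperators Real

namespace Summit.QuantumFields.BalabanUV.Beta.GAN24.FibreRateFeed

open Literature.MathematicalPhysics.QuantumFieldTheory.Balaban1983to89.B4Strip (ofRealVec)
open Literature.MathematicalPhysics.QuantumFieldTheory.King1986 (momSq momSq_nonneg)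
open CapacitanceScalarBounds (momSq_pos)

/-! ## §1 The gauge constant `cSol` as «Cap⁻¹ blocks × source-side sums»; scaled bounds and rates of `(φ, c)` -/

section CSol
open Literature.Probability.LatticeModels (TorusSite)
open AliasObjects (cap capSol phiSol cSol srcPhi srcC eVec)
open CapacitanceEndpointBlocks (cPP cPc ccc cPP_pos cPc_pos ccc_pos)
open CapacitanceRateDictionary (scaled_cap_inv_inl_inl scaled_cap_inv_inl_inr scaled_cap_inv_inr_inl scaled_cap_inv_inr_inr
  norm_invPP_aT_le norm_invPc_aT_le norm_invcP_aT_le norm_invcc_aT_le)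
open CapacitanceRateScaled (crPP crPc crcc scaled_cap_inv_inl_inl_rate scaled_cap_inv_inl_inr_rate scaled_cap_inv_inr_inl_rate
  scaled_cap_inv_inr_inr_rate)
open FibreRateMF (phiSol_eq_sum scaled_phiSol_eq)

variable {D : ℕ}

/-- [folklore] **`cSol` IS THE `c`-ROW OF `(cap N p)⁻¹` AGAINST THE SOURCES**: `cSol N p f̂ ĉ = Σ_{l′} (cap⁻¹)_{cl′}·r_φ(l′) + (cap⁻¹)_{cc}·r_c`. -/
theorem cSol_eq_sum (N : ℕ) [NeZero N] (p : Fin D → ℂ) (fhat : TorusSite D N → Fin D → ℂ) (chat : Fin D → ℂ) :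
    cSol N p fhat chat = ∑ l', (cap N p)⁻¹ (Sum.inr ()) (Sum.inl l') * srcPhi N p fhat chat l'
      + (cap N p)⁻¹ (Sum.inr ()) (Sum.inr ()) * srcC N p fhat := by
  unfold AliasObjects.cSol AliasObjects.capSol
  simp [Matrix.mulVec, dotProduct, Fintype.sum_sum_type]

/-- [folklore] SCALED FORM of `cSol`: `N^{D+1}·c = Σ_{l′} (N^{D+4}(cap⁻¹)_{cl′})·(N⁻³ r_φ(l′)) + (N^{D+4}(cap⁻¹)_{cc})·(N⁻³ r_c)`. -/
theorem scaled_cSol_eq {N : ℕ} [NeZero N] (hN : 1 ≤ N) (p : Fin D → ℂ) (fhat : TorusSite D N → Fin D → ℂ) (chat : Fin D → ℂ) :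
    (N : ℂ) ^ (D + 1) * cSol N p fhat chat
      = ∑ l', ((N : ℂ) ^ (D + 4) * (cap N p)⁻¹ (Sum.inr ()) (Sum.inl l')) * ((((N : ℂ) ^ 3)⁻¹) * srcPhi N p fhat chat l')
        + ((N : ℂ) ^ (D + 4) * (cap N p)⁻¹ (Sum.inr ()) (Sum.inr ())) * ((((N : ℂ) ^ 3)⁻¹) * srcC N p fhat) := by
  have hN0 : (N : ℂ) ≠ 0 := by exact_mod_cast (by omega : N ≠ 0)
  have e : ∀ X S : ℂ, (N : ℂ) ^ (D + 1) * (X * S) = ((N : ℂ) ^ (D + 4) * X) * ((((N : ℂ) ^ 3)⁻¹) * S) := by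
    intro X S; field_simp; ring
  rw [cSol_eq_sum, mul_add, Finset.mul_sum]
  simp only [e]

/-- [folklore] With no force and the unit constraint source `e_l`: `cSol N p 0 (eVec l) = (cap N p)⁻¹ (inr ()) (inl l)`. -/
theorem cSol_zero_eVec (N : ℕ) [NeZero N] (p : Fin D → ℂ) (l : Fin D) :
    cSol N p 0 (eVec l) = (cap N p)⁻¹ (Sum.inr ()) (Sum.inl l) := by
  have hφ : srcPhi N p 0 (eVec l) = eVec l := by
    funext κ'
    simp [AliasObjects.srcPhi, AliasObjects.piPerp, FibreBlockSolve.dot]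
  have hc : srcC N p 0 = 0 := by
    simp [AliasObjects.srcC, FibreBlockSolve.dot]
  rw [cSol_eq_sum, hφ, hc]
  simp [AliasObjects.eVec]

variable {N N' : ℕ} [NeZero N] [NeZero N'] {q : Fin D → ℝ}

/-- **BOUND OF THE SCALED MULTIPLIER RESPONSE** [folklore]: from `‖N⁻³ r_φ(l′)‖ ≤ B_φ`, `‖N⁻³ r_c‖ ≤ B_c`:
`‖N^{D+1}·φ_κ‖ ≤ D·cPP·|q|²·B_φ + cPc·|q|²√|q|²·B_c`. -/
theorem norm_scaled_phiSol_le (hN : 1 ≤ N) (hq : ∀ i, |q i| ≤ π) (hq0 : q ≠ 0) {fhat : TorusSite D N → Fin D → ℂ} {Bφ Bc : ℝ}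
    (hBφ : ∀ l', ‖(((N : ℂ) ^ 3)⁻¹) * srcPhi N (ofRealVec q) fhat 0 l'‖ ≤ Bφ) (hBc : ‖(((N : ℂ) ^ 3)⁻¹) * srcC N (ofRealVec q) fhat‖ ≤ Bc)
    (κ : Fin D) :
    ‖(N : ℂ) ^ (D + 1) * phiSol N (ofRealVec q) fhat 0 κ‖ ≤ D * (cPP D * momSq q * Bφ) + cPc D * (momSq q * Real.sqrt (momSq q)) * Bc := by
  rw [scaled_phiSol_eq hN]
  refine (norm_add_le _ _).trans (add_le_add ?_ ?_)
  · refine (norm_sum_le _ _).trans ?_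
    calc ∑ l', ‖(N : ℂ) ^ (D + 4) * (cap N (ofRealVec q))⁻¹ (Sum.inl κ) (Sum.inl l') * ((((N : ℂ) ^ 3)⁻¹) * srcPhi N (ofRealVec q) fhat 0 l')‖
        ≤ ∑ _l' : Fin D, cPP D * momSq q * Bφ := Finset.sum_le_sum fun l' _ => by
          rw [norm_mul]
          have hX : ‖(N : ℂ) ^ (D + 4) * (cap N (ofRealVec q))⁻¹ (Sum.inl κ) (Sum.inl l')‖ ≤ cPP D * momSq q := by
            rw [scaled_cap_inv_inl_inl hN hq hq0]; exact norm_invPP_aT_le hN hq hq0 κ l'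
          exact mul_le_mul hX (hBφ l') (norm_nonneg _) ((norm_nonneg _).trans hX)
      _ = D * (cPP D * momSq q * Bφ) := by simp
  · rw [norm_mul]
    have hX : ‖(N : ℂ) ^ (D + 4) * (cap N (ofRealVec q))⁻¹ (Sum.inl κ) (Sum.inr ())‖ ≤ cPc D * (momSq q * Real.sqrt (momSq q)) := by
      rw [scaled_cap_inv_inl_inr hN hq hq0]; exact norm_invPc_aT_le hN hq hq0 κ
    exact mul_le_mul hX hBc (norm_nonneg _) ((norm_nonneg _).trans hX)

/-- **BOUND OF THE SCALED GAUGE CONSTANT** [folklore]: `‖N^{D+1}·c‖ ≤ D·cPc·|q|²√|q|²·B_φ + ccc·|q|⁴·B_c`. -/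
theorem norm_scaled_cSol_le (hN : 1 ≤ N) (hq : ∀ i, |q i| ≤ π) (hq0 : q ≠ 0) {fhat : TorusSite D N → Fin D → ℂ} {Bφ Bc : ℝ}
    (hBφ : ∀ l', ‖(((N : ℂ) ^ 3)⁻¹) * srcPhi N (ofRealVec q) fhat 0 l'‖ ≤ Bφ) (hBc : ‖(((N : ℂ) ^ 3)⁻¹) * srcC N (ofRealVec q) fhat‖ ≤ Bc) :
    ‖(N : ℂ) ^ (D + 1) * cSol N (ofRealVec q) fhat 0‖ ≤ D * (cPc D * (momSq q * Real.sqrt (momSq q)) * Bφ) + ccc D * momSq q ^ 2 * Bc := by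
  rw [scaled_cSol_eq hN]
  refine (norm_add_le _ _).trans (add_le_add ?_ ?_)
  · refine (norm_sum_le _ _).trans ?_
    calc ∑ l', ‖(N : ℂ) ^ (D + 4) * (cap N (ofRealVec q))⁻¹ (Sum.inr ()) (Sum.inl l') * ((((N : ℂ) ^ 3)⁻¹) * srcPhi N (ofRealVec q) fhat 0 l')‖
        ≤ ∑ _l' : Fin D, cPc D * (momSq q * Real.sqrt (momSq q)) * Bφ := Finset.sum_le_sum fun l' _ => by
          rw [norm_mul]
          have hX : ‖(N : ℂ) ^ (D + 4) * (cap N (ofRealVec q))⁻¹ (Sum.inr ()) (Sum.inl l')‖ ≤ cPc D * (momSq q * Real.sqrt (momSq q)) := by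
            rw [scaled_cap_inv_inr_inl hN hq hq0]; exact norm_invcP_aT_le hN hq hq0 l'
          exact mul_le_mul hX (hBφ l') (norm_nonneg _) ((norm_nonneg _).trans hX)
      _ = D * (cPc D * (momSq q * Real.sqrt (momSq q)) * Bφ) := by simp
  · rw [norm_mul]
    have hX : ‖(N : ℂ) ^ (D + 4) * (cap N (ofRealVec q))⁻¹ (Sum.inr ()) (Sum.inr ())‖ ≤ ccc D * momSq q ^ 2 := by
      rw [scaled_cap_inv_inr_inr hN hq hq0]; exact norm_invcc_aT_le hN hq hq0
    exact mul_le_mul hX hBc (norm_nonneg _) ((norm_nonneg _).trans hX)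

/-- **TWO-LEVEL RATE OF THE SCALED GAUGE CONSTANT, AS A FUNCTION OF THE SOURCE-SIDE DATA** [folklore] (`1 ≤ N ≤ N′`, zero constraint source):
`‖N′^{D+1} c′ − N^{D+1} c‖ ≤ (D·(crPc·|q|⁴√|q|²·B_φ + cPc·|q|²√|q|²·R_φ) + crcc·|q|⁶·B_c + ccc·|q|⁴·R_c)/N²`. -/
theorem norm_scaled_cSol_sub_le (hN : 1 ≤ N) (hNN' : N ≤ N') (hq : ∀ i, |q i| ≤ π) (hq0 : q ≠ 0)
    {fhat : TorusSite D N → Fin D → ℂ} {fhat' : TorusSite D N' → Fin D → ℂ} {Bφ Bc Rφ Rc : ℝ}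
    (hBφ : ∀ l', ‖(((N' : ℂ) ^ 3)⁻¹) * srcPhi N' (ofRealVec q) fhat' 0 l'‖ ≤ Bφ)
    (hBc : ‖(((N' : ℂ) ^ 3)⁻¹) * srcC N' (ofRealVec q) fhat'‖ ≤ Bc)
    (hRφ : ∀ l', ‖(((N' : ℂ) ^ 3)⁻¹) * srcPhi N' (ofRealVec q) fhat' 0 l' - (((N : ℂ) ^ 3)⁻¹) * srcPhi N (ofRealVec q) fhat 0 l'‖ ≤ Rφ / (N : ℝ) ^ 2)
    (hRc : ‖(((N' : ℂ) ^ 3)⁻¹) * srcC N' (ofRealVec q) fhat' - (((N : ℂ) ^ 3)⁻¹) * srcC N (ofRealVec q) fhat‖ ≤ Rc / (N : ℝ) ^ 2) :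
    ‖(N' : ℂ) ^ (D + 1) * cSol N' (ofRealVec q) fhat' 0 - (N : ℂ) ^ (D + 1) * cSol N (ofRealVec q) fhat 0‖
      ≤ (D * (crPc D * (momSq q ^ 2 * Real.sqrt (momSq q)) * Bφ + cPc D * (momSq q * Real.sqrt (momSq q)) * Rφ)
          + crcc D * momSq q ^ 3 * Bc + ccc D * momSq q ^ 2 * Rc) / (N : ℝ) ^ 2 := by
  have hN' : 1 ≤ N' := hN.trans hNN'
  have hN0 : (0 : ℝ) < N := by exact_mod_cast hN
  rw [scaled_cSol_eq hN', scaled_cSol_eq hN, show ∀ (a b c e : ℂ), (a + b) - (c + e) = (a - c) + (b - e) from fun _ _ _ _ => by ring,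
    ← Finset.sum_sub_distrib]
  have hX : ∀ l', ‖(N : ℂ) ^ (D + 4) * (cap N (ofRealVec q))⁻¹ (Sum.inr ()) (Sum.inl l')‖ ≤ cPc D * (momSq q * Real.sqrt (momSq q)) :=
    fun l' => by rw [scaled_cap_inv_inr_inl hN hq hq0]; exact norm_invcP_aT_le hN hq hq0 l'
  have hΔX : ∀ l', ‖(N' : ℂ) ^ (D + 4) * (cap N' (ofRealVec q))⁻¹ (Sum.inr ()) (Sum.inl l')
      - (N : ℂ) ^ (D + 4) * (cap N (ofRealVec q))⁻¹ (Sum.inr ()) (Sum.inl l')‖ ≤ crPc D * (momSq q ^ 2 * Real.sqrt (momSq q)) / (N : ℝ) ^ 2 :=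
    fun l' => scaled_cap_inv_inr_inl_rate hN hNN' hq hq0 () l'
  have hXc : ‖(N : ℂ) ^ (D + 4) * (cap N (ofRealVec q))⁻¹ (Sum.inr ()) (Sum.inr ())‖ ≤ ccc D * momSq q ^ 2 := by
    rw [scaled_cap_inv_inr_inr hN hq hq0]; exact norm_invcc_aT_le hN hq hq0
  have hΔXc : ‖(N' : ℂ) ^ (D + 4) * (cap N' (ofRealVec q))⁻¹ (Sum.inr ()) (Sum.inr ())
      - (N : ℂ) ^ (D + 4) * (cap N (ofRealVec q))⁻¹ (Sum.inr ()) (Sum.inr ())‖ ≤ crcc D * momSq q ^ 3 / (N : ℝ) ^ 2 :=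
    scaled_cap_inv_inr_inr_rate hN hNN' hq hq0 () ()
  refine (norm_add_le _ _).trans ?_
  have hsum : ‖∑ l', ((N' : ℂ) ^ (D + 4) * (cap N' (ofRealVec q))⁻¹ (Sum.inr ()) (Sum.inl l') * ((((N' : ℂ) ^ 3)⁻¹) * srcPhi N' (ofRealVec q) fhat' 0 l')
        - (N : ℂ) ^ (D + 4) * (cap N (ofRealVec q))⁻¹ (Sum.inr ()) (Sum.inl l') * ((((N : ℂ) ^ 3)⁻¹) * srcPhi N (ofRealVec q) fhat 0 l'))‖
      ≤ D * (crPc D * (momSq q ^ 2 * Real.sqrt (momSq q)) * Bφ + cPc D * (momSq q * Real.sqrt (momSq q)) * Rφ) / (N : ℝ) ^ 2 := by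
    refine (norm_sum_le _ _).trans ?_
    calc ∑ l', ‖(N' : ℂ) ^ (D + 4) * (cap N' (ofRealVec q))⁻¹ (Sum.inr ()) (Sum.inl l') * ((((N' : ℂ) ^ 3)⁻¹) * srcPhi N' (ofRealVec q) fhat' 0 l')
          - (N : ℂ) ^ (D + 4) * (cap N (ofRealVec q))⁻¹ (Sum.inr ()) (Sum.inl l') * ((((N : ℂ) ^ 3)⁻¹) * srcPhi N (ofRealVec q) fhat 0 l')‖
        ≤ ∑ _l' : Fin D, (crPc D * (momSq q ^ 2 * Real.sqrt (momSq q)) / (N : ℝ) ^ 2 * Bφ + cPc D * (momSq q * Real.sqrt (momSq q)) * (Rφ / (N : ℝ) ^ 2)) :=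
          Finset.sum_le_sum fun l' _ => ClosedFormRateOfParts.norm_mul_sub_mul_le_of_bounds (hX l') (hBφ l') (hΔX l') (hRφ l')
      _ = D * (crPc D * (momSq q ^ 2 * Real.sqrt (momSq q)) * Bφ + cPc D * (momSq q * Real.sqrt (momSq q)) * Rφ) / (N : ℝ) ^ 2 := by
          rw [Finset.sum_const, Finset.card_univ, Fintype.card_fin, nsmul_eq_mul]
          field_simp
  have hc : ‖(N' : ℂ) ^ (D + 4) * (cap N' (ofRealVec q))⁻¹ (Sum.inr ()) (Sum.inr ()) * ((((N' : ℂ) ^ 3)⁻¹) * srcC N' (ofRealVec q) fhat')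
        - (N : ℂ) ^ (D + 4) * (cap N (ofRealVec q))⁻¹ (Sum.inr ()) (Sum.inr ()) * ((((N : ℂ) ^ 3)⁻¹) * srcC N (ofRealVec q) fhat)‖
      ≤ (crcc D * momSq q ^ 3 * Bc + ccc D * momSq q ^ 2 * Rc) / (N : ℝ) ^ 2 := by
    refine (ClosedFormRateOfParts.norm_mul_sub_mul_le_of_bounds hXc hBc hΔXc hRc).trans (le_of_eq ?_)
    field_simp
  refine (add_le_add hsum hc).trans (le_of_eq ?_)
  field_simp
  ring

end CSol

/-! ## §2 The feed readout decompositions (leaf-11's `readW_mul_Asol_feed` BY NAME) -/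

section Feed
open Literature.Probability.LatticeModels (TorusSite)
open FibreBlockSolve (Asol)
open AliasObjects (cap phiSol cSol srcPhi srcC eVec readW Ahat gAl fhatF dAl dbAl LAl chiAl sbAl)
open FibreRateFeedTerms (rPhiTerm rCTerm readW_mul_Asol_feed)
open FibreRateTBlock (tTerm ff_summand_split)
open FibreRateMM (phiSol_zero_eVec)

variable {D : ℕ} (N M : ℕ) [NeZero N] (p : Fin D → ℂ)

/-- [folklore] With NO force the field amplitude is pure feed: `Â(m) = Asol(∂_m, ∂♭_m, χ̂_m s♭(m) ⊙ φ, L_m, χ̂_m c)` (`f̂ = 0`). -/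
theorem Ahat_zero_eq_feed (chat : Fin D → ℂ) (m : TorusSite D N) :
    Ahat N p 0 chat m = Asol (dAl N p m) (dbAl N p m) (fun l' => chiAl N p m * sbAl N p m l' * phiSol N p 0 chat l') (LAl N p m)
      (chiAl N p m * cSol N p 0 chat) := by
  unfold AliasObjects.Ahat
  congr 1
  funext κ
  simp [AliasObjects.gAl]

/-- **fm READOUT = READING-SIDE SUMS × A COLUMN OF `(cap N p)⁻¹`** [folklore]: with `f̂ = 0`, `ĉ = e_l`,
`Σ_m readW(m,κ,x′)·Â_κ(m) = Σ_{l′} (Σ_m R_φ(m;κ,l′;x′))·(cap⁻¹)_{l′l} + (Σ_m R_c(m;κ;x′))·(cap⁻¹)_{cl}` (every complex `p`). -/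
theorem sum_readW_Ahat_zero_eVec (κ l : Fin D) (x' : Fin D → ℤ) :
    ∑ m, readW N M p m κ x' * Ahat N p 0 (eVec l) m κ
      = ∑ l', (∑ m, rPhiTerm N M p m κ l' x') * (cap N p)⁻¹ (Sum.inl l') (Sum.inl l)
        + (∑ m, rCTerm N M p m κ x') * (cap N p)⁻¹ (Sum.inr ()) (Sum.inl l) := by
  have e : ∀ m, readW N M p m κ x' * Ahat N p 0 (eVec l) m κ
      = ∑ l', rPhiTerm N M p m κ l' x' * (cap N p)⁻¹ (Sum.inl l') (Sum.inl l) + rCTerm N M p m κ x' * (cap N p)⁻¹ (Sum.inr ()) (Sum.inl l) := by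
    intro m
    rw [Ahat_zero_eq_feed, readW_mul_Asol_feed, cSol_zero_eVec]
    simp only [phiSol_zero_eVec]
  rw [Finset.sum_congr rfl fun m _ => e m, Finset.sum_add_distrib, Finset.sum_comm, ← Finset.sum_mul]
  congr 1
  exact Finset.sum_congr rfl fun l' _ => by rw [Finset.sum_mul]

/-- **ff READOUT = T-SHARE + READING-SIDE SUMS × (φ, c)** [folklore]: for the force source `fhatF N M p l y′` and constraint source `ĉ`,
`Σ_m readW·Â = Σ_m tTerm + Σ_{l′} (Σ_m R_φ)·φ_{l′} + (Σ_m R_c)·c` with `(φ, c) = (phiSol, cSol)(f̂, ĉ)` (leaf-11's `ff_summand_split` +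
`readW_mul_Asol_feed` BY NAME, summed). -/
theorem sum_readW_Ahat_fhatF (κ l : Fin D) (x' y' : Fin D → ℤ) (chat : Fin D → ℂ) :
    ∑ m, readW N M p m κ x' * Ahat N p (fhatF N M p l y') chat m κ
      = ∑ m, tTerm N M p m κ l x' y'
        + (∑ l', (∑ m, rPhiTerm N M p m κ l' x') * phiSol N p (fhatF N M p l y') chat l'
          + (∑ m, rCTerm N M p m κ x') * cSol N p (fhatF N M p l y') chat) := by
  have e : ∀ m, readW N M p m κ x' * Ahat N p (fhatF N M p l y') chat m κ
      = tTerm N M p m κ l x' y' + (∑ l', rPhiTerm N M p m κ l' x' * phiSol N p (fhatF N M p l y') chat l'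
          + rCTerm N M p m κ x' * cSol N p (fhatF N M p l y') chat) := by
    intro m
    rw [ff_summand_split, readW_mul_Asol_feed]
  rw [Finset.sum_congr rfl fun m _ => e m, Finset.sum_add_distrib, Finset.sum_add_distrib, Finset.sum_comm, ← Finset.sum_mul]
  congr 2
  exact Finset.sum_congr rfl fun l' _ => by rw [Finset.sum_mul]

end Feed

/-! ## §3 The field–multiplier leg: two-level rate as a function of the reading-side data -/

section FM
open Literature.Probability.LatticeModels (TorusSite)
open AliasObjects (cap readW Ahat eVec)
open FibreRateFeedTerms (rPhiTerm rCTerm)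
open CombesThomas (sfStep smStep)
open CapacitanceEndpointBlocks (cPP cPc)
open CapacitanceRateDictionary (scaled_cap_inv_inl_inl scaled_cap_inv_inr_inl norm_invPP_aT_le norm_invcP_aT_le)
open CapacitanceRateScaled (crPP crPc scaled_cap_inv_inl_inl_rate scaled_cap_inv_inr_inl_rate)

variable {D : ℕ} {N N' : ℕ} [NeZero N] [NeZero N'] {q : Fin D → ℝ}

/-- [folklore] SCALED fm readout: `N^{D+1}·Σ_m readW·Â = Σ_{l′} (N⁻³·Σ_m R_φ)·(N^{D+4}(cap⁻¹)_{l′l}) + (N⁻³·Σ_m R_c)·(N^{D+4}(cap⁻¹)_{cl})`. -/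
theorem scaled_fm_eq (hN : 1 ≤ N) (M : ℕ) (p : Fin D → ℂ) (κ l : Fin D) (x' : Fin D → ℤ) :
    (N : ℂ) ^ (D + 1) * ∑ m, readW N M p m κ x' * Ahat N p 0 (eVec l) m κ
      = ∑ l', ((((N : ℂ) ^ 3)⁻¹) * ∑ m, rPhiTerm N M p m κ l' x') * ((N : ℂ) ^ (D + 4) * (cap N p)⁻¹ (Sum.inl l') (Sum.inl l))
        + ((((N : ℂ) ^ 3)⁻¹) * ∑ m, rCTerm N M p m κ x') * ((N : ℂ) ^ (D + 4) * (cap N p)⁻¹ (Sum.inr ()) (Sum.inl l)) := by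
  have hN0 : (N : ℂ) ≠ 0 := by exact_mod_cast (by omega : N ≠ 0)
  have e : ∀ R X : ℂ, (N : ℂ) ^ (D + 1) * (R * X) = ((((N : ℂ) ^ 3)⁻¹) * R) * ((N : ℂ) ^ (D + 4) * X) := by
    intro R X; field_simp; ring
  rw [sum_readW_Ahat_zero_eVec, mul_add, Finset.mul_sum]
  simp only [e]

/-- **TWO-LEVEL RATE OF THE SCALED fm READOUT, AS A FUNCTION OF THE READING-SIDE DATA** [folklore] (`1 ≤ N ≤ N′`, `q ∈ [−π, π]^D ∖ {0}`):
from `‖N⁻³Σ_m R_φ(κ,l′)‖ ≤ A_φ`, `‖N⁻³Σ_m R_c(κ)‖ ≤ A_c` (level `N`) and the rates `≤ Q_φ/N²`, `≤ Q_c/N²` (PART S via `R = −conj S`, leaf-07),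
`‖N′^{D+1}F′ − N^{D+1}F‖ ≤ (D·(Q_φ·cPP·|q|² + A_φ·crPP·|q|⁴) + Q_c·cPc·|q|²√|q|² + A_c·crPc·|q|⁴√|q|²)/N²`. -/
theorem norm_scaled_fm_sub_le (hN : 1 ≤ N) (hNN' : N ≤ N') (hq : ∀ i, |q i| ≤ π) (hq0 : q ≠ 0) (M M' : ℕ) {Aφ Ac Qφ Qc : ℝ}
    (κ l : Fin D) (x' : Fin D → ℤ)
    (hAφ : ∀ l', ‖(((N : ℂ) ^ 3)⁻¹) * ∑ m, rPhiTerm N M (ofRealVec q) m κ l' x'‖ ≤ Aφ)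
    (hAc : ‖(((N : ℂ) ^ 3)⁻¹) * ∑ m, rCTerm N M (ofRealVec q) m κ x'‖ ≤ Ac)
    (hQφ : ∀ l', ‖(((N' : ℂ) ^ 3)⁻¹) * ∑ m, rPhiTerm N' M' (ofRealVec q) m κ l' x' - (((N : ℂ) ^ 3)⁻¹) * ∑ m, rPhiTerm N M (ofRealVec q) m κ l' x'‖
      ≤ Qφ / (N : ℝ) ^ 2)
    (hQc : ‖(((N' : ℂ) ^ 3)⁻¹) * ∑ m, rCTerm N' M' (ofRealVec q) m κ x' - (((N : ℂ) ^ 3)⁻¹) * ∑ m, rCTerm N M (ofRealVec q) m κ x'‖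
      ≤ Qc / (N : ℝ) ^ 2) :
    ‖(N' : ℂ) ^ (D + 1) * ∑ m, readW N' M' (ofRealVec q) m κ x' * Ahat N' (ofRealVec q) 0 (eVec l) m κ
        - (N : ℂ) ^ (D + 1) * ∑ m, readW N M (ofRealVec q) m κ x' * Ahat N (ofRealVec q) 0 (eVec l) m κ‖
      ≤ (D * (Qφ * (cPP D * momSq q) + Aφ * (crPP D * momSq q ^ 2))
          + Qc * (cPc D * (momSq q * Real.sqrt (momSq q))) + Ac * (crPc D * (momSq q ^ 2 * Real.sqrt (momSq q)))) / (N : ℝ) ^ 2 := by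
  have hN' : 1 ≤ N' := hN.trans hNN'
  have hN0 : (0 : ℝ) < N := by exact_mod_cast hN
  rw [scaled_fm_eq hN', scaled_fm_eq hN, show ∀ (a b c e : ℂ), (a + b) - (c + e) = (a - c) + (b - e) from fun _ _ _ _ => by ring,
    ← Finset.sum_sub_distrib]
  have hX' : ∀ l', ‖(N' : ℂ) ^ (D + 4) * (cap N' (ofRealVec q))⁻¹ (Sum.inl l') (Sum.inl l)‖ ≤ cPP D * momSq q :=
    fun l' => by rw [scaled_cap_inv_inl_inl hN' hq hq0]; exact norm_invPP_aT_le hN' hq hq0 l' l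
  have hΔX : ∀ l', ‖(N' : ℂ) ^ (D + 4) * (cap N' (ofRealVec q))⁻¹ (Sum.inl l') (Sum.inl l)
      - (N : ℂ) ^ (D + 4) * (cap N (ofRealVec q))⁻¹ (Sum.inl l') (Sum.inl l)‖ ≤ crPP D * momSq q ^ 2 / (N : ℝ) ^ 2 :=
    fun l' => scaled_cap_inv_inl_inl_rate hN hNN' hq hq0 l' l
  have hXc' : ‖(N' : ℂ) ^ (D + 4) * (cap N' (ofRealVec q))⁻¹ (Sum.inr ()) (Sum.inl l)‖ ≤ cPc D * (momSq q * Real.sqrt (momSq q)) := by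
    rw [scaled_cap_inv_inr_inl hN' hq hq0]; exact norm_invcP_aT_le hN' hq hq0 l
  have hΔXc : ‖(N' : ℂ) ^ (D + 4) * (cap N' (ofRealVec q))⁻¹ (Sum.inr ()) (Sum.inl l)
      - (N : ℂ) ^ (D + 4) * (cap N (ofRealVec q))⁻¹ (Sum.inr ()) (Sum.inl l)‖ ≤ crPc D * (momSq q ^ 2 * Real.sqrt (momSq q)) / (N : ℝ) ^ 2 :=
    scaled_cap_inv_inr_inl_rate hN hNN' hq hq0 () l
  refine (norm_add_le _ _).trans ?_
  have hsum : ‖∑ l', ((((N' : ℂ) ^ 3)⁻¹) * (∑ m, rPhiTerm N' M' (ofRealVec q) m κ l' x') * ((N' : ℂ) ^ (D + 4) * (cap N' (ofRealVec q))⁻¹ (Sum.inl l') (Sum.inl l))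
        - (((N : ℂ) ^ 3)⁻¹) * (∑ m, rPhiTerm N M (ofRealVec q) m κ l' x') * ((N : ℂ) ^ (D + 4) * (cap N (ofRealVec q))⁻¹ (Sum.inl l') (Sum.inl l)))‖
      ≤ D * (Qφ * (cPP D * momSq q) + Aφ * (crPP D * momSq q ^ 2)) / (N : ℝ) ^ 2 := by
    refine (norm_sum_le _ _).trans ?_
    calc ∑ l', ‖(((N' : ℂ) ^ 3)⁻¹) * (∑ m, rPhiTerm N' M' (ofRealVec q) m κ l' x') * ((N' : ℂ) ^ (D + 4) * (cap N' (ofRealVec q))⁻¹ (Sum.inl l') (Sum.inl l))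
          - (((N : ℂ) ^ 3)⁻¹) * (∑ m, rPhiTerm N M (ofRealVec q) m κ l' x') * ((N : ℂ) ^ (D + 4) * (cap N (ofRealVec q))⁻¹ (Sum.inl l') (Sum.inl l))‖
        ≤ ∑ _l' : Fin D, (Qφ / (N : ℝ) ^ 2 * (cPP D * momSq q) + Aφ * (crPP D * momSq q ^ 2 / (N : ℝ) ^ 2)) :=
          Finset.sum_le_sum fun l' _ => ClosedFormRateOfParts.norm_mul_sub_mul_le_of_bounds (hAφ l') (hX' l') (hQφ l') (hΔX l')
      _ = D * (Qφ * (cPP D * momSq q) + Aφ * (crPP D * momSq q ^ 2)) / (N : ℝ) ^ 2 := by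
          rw [Finset.sum_const, Finset.card_univ, Fintype.card_fin, nsmul_eq_mul]
          field_simp
  have hc : ‖(((N' : ℂ) ^ 3)⁻¹) * (∑ m, rCTerm N' M' (ofRealVec q) m κ x') * ((N' : ℂ) ^ (D + 4) * (cap N' (ofRealVec q))⁻¹ (Sum.inr ()) (Sum.inl l))
        - (((N : ℂ) ^ 3)⁻¹) * (∑ m, rCTerm N M (ofRealVec q) m κ x') * ((N : ℂ) ^ (D + 4) * (cap N (ofRealVec q))⁻¹ (Sum.inr ()) (Sum.inl l))‖
      ≤ (Qc * (cPc D * (momSq q * Real.sqrt (momSq q))) + Ac * (crPc D * (momSq q ^ 2 * Real.sqrt (momSq q)))) / (N : ℝ) ^ 2 := by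
    refine (ClosedFormRateOfParts.norm_mul_sub_mul_le_of_bounds hAc hXc' hQc hΔXc).trans (le_of_eq ?_)
    field_simp
  refine (add_le_add hsum hc).trans (le_of_eq ?_)
  field_simp
  ring

end FM

end Summit.QuantumFields.BalabanUV.Beta.GAN24.FibreRateFeed

end
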